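import Summits.Ventures.PercRepro.RankDistIrreducible
import Summits.Ventures.PercRepro.RankDistColoop

/-!
# PercRepro — (SC) for every matroid from (SC) on the irreducible matroids (p9, gen 18)

THE FULL REDUCTION. `Irreducible M q`: `M` has no loop, no coloop and no element free at `q` — every element
lies in a cocircuit `C*` with `ρ(C* ∖ e) ≤ q` (`RankDistMinorBottom.FreeAt`). Deleting a loop
(`shadowCumulative_of_isLoop`), deleting a coloop (`shadowCumulative_of_isColoop`) and deleting / contracting a
free element (`shadowCumulative_of_delete_contract`) each inherit the cumulative shadow inequality from strictly
smaller matroids; the level `q = 0` reached by contraction is a theorem (`shadowCumulative_zero`). Hence, by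
strong induction on the size of the ground set (`shadowCumulative_of_irreducible`): **if `ShadowCumulative`
holds at every `(p'+1, q'+1)` on every irreducible matroid of rank `p'+1`, it holds at every `(p+1, q+1)` on
every finite matroid of rank `p+1`** — and with `rls_of_shadowCumulative`, C-025 at `(p, q)` would follow on
every matroid from (SC) on the irreducible ones. `U_{p,p+q}` (every `(q+1)`-set a cocircuit) and every
loopless, coloop-free matroid on the tight layer `|E| = p + q` are irreducible. Nothing here is a statement
about any window of the crux.
-/

namespace PercRepro.RankDist

open Set Finset Matroid PercRepro.ThmH

variable {α : Type}

/-- `Irreducible M q`: no loop, no coloop, no element free at `q`. -/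
def Irreducible (M : Matroid α) (q : ℕ) : Prop :=
  (∀ e : α, ¬ M.IsLoop e) ∧ (∀ e : α, ¬ M.IsColoop e) ∧ NoFreeElem M q

/-- Deleting a loop keeps the rank. -/
lemma eRank_delete_of_isLoop (M : Matroid α) {e : α} (he : M.IsLoop e) :
    (M.delete {e}).eRank = M.eRank := by
  rw [← Matroid.eRk_ground, ← Matroid.eRk_ground, Matroid.delete_ground,
    deleteElem_eRk_eq M (subset_refl _), ← eRk_insert_eq_of_mem_closure M (he.mem_closure (M.E \ {e})),
    Set.insert_sdiff_singleton, Set.insert_eq_of_mem he.mem_ground]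

variable [DecidableEq α]

/-- **(SC) FOR EVERY MATROID FROM (SC) ON THE IRREDUCIBLE MATROIDS.** -/
theorem shadowCumulative_of_irreducible
    (H : ∀ (N : Matroid α) [N.Finite] (p' q' : ℕ), Irreducible N (q' + 1) → N.eRank = (p' + 1 : ℕ) →
      ShadowCumulative N (p' + 1) (q' + 1))
    (M : Matroid α) [M.Finite] (p q : ℕ) (hr : M.eRank = (p + 1 : ℕ)) :
    ShadowCumulative M (p + 1) (q + 1) := by
  suffices key : ∀ n : ℕ, ∀ (N : Matroid α) [N.Finite], N.E.ncard = n → ∀ (p q : ℕ),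
      N.eRank = (p + 1 : ℕ) → ShadowCumulative N (p + 1) (q + 1) from key _ M rfl p q hr
  intro n
  induction n using Nat.strong_induction_on with
  | _ n ih =>
    intro N _ hn p q hr
    -- a loop
    by_cases hloop : ∃ e : α, N.IsLoop e
    · obtain ⟨e, he⟩ := hloop
      have hlt : (N.E \ {e}).ncard < n := by
        rw [← hn]; exact Set.ncard_sdiff_singleton_lt_of_mem he.mem_ground N.ground_finite
      exact shadowCumulative_of_isLoop N he
        (ih _ hlt (N.delete {e}) (by rw [Matroid.delete_ground]) p q
          (by rw [eRank_delete_of_isLoop N he, hr]))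
    -- a coloop
    by_cases hcoloop : ∃ e : α, N.IsColoop e
    · obtain ⟨e, he⟩ := hcoloop
      have hlt : (N.E \ {e}).ncard < n := by
        rw [← hn]; exact Set.ncard_sdiff_singleton_lt_of_mem he.mem_ground N.ground_finite
      have hrD : (N.delete {e}).eRank = (p : ℕ) := by
        have h2 := eRank_delete_of_isColoop_add_one N he
        rw [hr] at h2
        exact WithTop.add_right_cancel ENat.one_ne_top (h2.trans (Nat.cast_succ p))
      apply shadowCumulative_of_isColoop N he hr
      rcases Nat.eq_zero_or_pos p with rfl | hp
      · intro u _ hup; omega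
      · obtain ⟨p', rfl⟩ : ∃ p', p = p' + 1 := ⟨p - 1, by omega⟩
        exact ih _ hlt (N.delete {e}) (by rw [Matroid.delete_ground]) p' q hrD
    -- a free element
    by_cases hfree : ∃ e : α, FreeAt N (q + 1) e
    · obtain ⟨e, he⟩ := hfree
      have hlt : (N.E \ {e}).ncard < n := by
        rw [← hn]; exact Set.ncard_sdiff_singleton_lt_of_mem he.1.mem_ground N.ground_finite
      have hD : ShadowCumulative (N.delete {e}) (p + 1) (q + 1) :=
        ih _ hlt (N.delete {e}) (by rw [Matroid.delete_ground]) p q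
          (by rw [eRank_delete_of_freeAt N he, hr])
      have hrC : (N.contract {e}).eRank = (p : ℕ) := by
        have h1 := eRank_contract_add_one N he.1
        rw [hr] at h1
        exact WithTop.add_right_cancel ENat.one_ne_top (h1.trans (Nat.cast_succ p))
      have hC : ShadowCumulative (N.contract {e}) p q := by
        rcases Nat.eq_zero_or_pos q with rfl | hq
        · exact shadowCumulative_zero (N.contract {e}) p hrC
        · obtain ⟨q', rfl⟩ : ∃ q', q = q' + 1 := ⟨q - 1, by omega⟩
          rcases Nat.eq_zero_or_pos p with rfl | hp
          · intro u hqu hup; omega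
          · obtain ⟨p', rfl⟩ : ∃ p', p = p' + 1 := ⟨p - 1, by omega⟩
            exact ih _ hlt (N.contract {e}) (by rw [Matroid.contract_ground]) p' q' hrC
      exact shadowCumulative_of_delete_contract N he hr hD hC
    -- irreducible
    · exact H N p q ⟨fun e he => hloop ⟨e, he⟩, fun e he => hcoloop ⟨e, he⟩,
        fun e he => hfree ⟨e, he⟩⟩ hr

end PercRepro.RankDist
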